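import Summits.QuantumFields.YangMills.Theorems.UnitScaleTiltHistoryTailLaneNumerator
import Summits.QuantumFields.YangMills.Theorems.UnitScaleTiltHistoryTailIntEnvelopeRows
import HarnessLib

/-!
# Route `UnitScaleTilt` — crux K2-L `HistoryTailL` (stmt-QuantumFields-19936), R-57χ successor line: MECHANISM A's NUMERATOR BOUND ON A JOINT LARGE-PLAQUETTE EVENT AT THE
# INTERIOR DATUM OF A FAMILY OF DATA CORES (`HistoryTailLaneNumerator` §2.1 `setIntegral_up_le`, fleet lead `ym-ust-18916-p1` g5, VERBATIM with
# `h.dataT3v3 hc γ hγ hγ1 π ↦ dataIntRows qf π`; §1/§2.2/§3 of that file are datum-free and imported) — seat ym3-torus-p2 (g16); `--supports` 19936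

v4 NOTE (2026-08-28, seat ym-ust-19936-w4 g4): this module is the ADDITIVE F-2b TWIN over ★alpha-1∕alpha-2's row-stable core `AlphaInputsT3AC.PkgCoreRows`
(`AlphaInputsT3ACv4CoreRows`, ★★OWNER RULING g26-№14 (F-2); ★alpha-2 g7 checklist 2026-08-28T08:14:03Z (s1)–(s7)) of the v3 module of the same name without the
`Rows` suffix: binder type `PkgCoreV3 ↦ PkgCoreRows`, `dataIntV3 ↦ dataIntRows`, namespace `+Rows`, imports re-pointed to the `Rows` twins; statement and proof otherwise
byte-identical.  The v3 module stays in the tree unchanged.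

Nothing of [Balaban1985UV3] is asserted; CONDITIONAL only on the family `qf`. [cite: Balaban1985UV3, (41) p.266, (47) p.267 and (71) p.273]
-/

set_option autoImplicit false

noncomputable section

open MeasureTheory
open Literature.MathematicalPhysics.QuantumFieldTheory.Balaban1983to89
open Literature.MathematicalPhysics.QuantumFieldTheory.Balaban1983to89.T3ContinuumYM3Torus
open Literature.MathematicalPhysics.QuantumFieldTheory.Balaban1983to89.T3UnitScaleTilt
open Literature.MathematicalPhysics.QuantumFieldTheory.Balaban1983to89.T3UnitLawDensityEML
open Literature.MathematicalPhysics.QuantumFieldTheory.Balaban1983to89.T3ThresholdSmallness (sqrt_coupling_pos_le)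
open Literature.MathematicalPhysics.QuantumFieldTheory.Balaban1983to89.T3Thresholds (coupling_le_one)
open Literature.MathematicalPhysics.QuantumFieldTheory.Balaban1983to89.T3AlphaInputsAC
open Literature.MathematicalPhysics.QuantumFieldTheory.Balaban1983to89.T3AlphaInputsACSchemas
open Literature.MathematicalPhysics.QuantumFieldTheory.Balaban1983to89.B10Eq38TorusDomains (toFine)
open Literature.MathematicalPhysics.QuantumFieldTheory.Balaban1983to89.T3RestrictedUnitDensity (resDensity integrable_resDensity)
open Literature.MathematicalPhysics.QuantumFieldTheory.Balaban1983to89.Missing (partitionFn measurable_plaqHol)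
open Summit.QuantumFields.Balaban3D.Carriers (suGroupModel)
open Summit.QuantumFields.Balaban3D.Proofs.Primitives (AlphaConsts)
open Summit.QuantumFields.Balaban3D.Proofs.Run3SmallFactors (regionT src_mem_plaqCover_of_mem_regionT)
open Summit.QuantumFields.YangMills.Theorems
open Summit.QuantumFields.YangMills.Theorems.HistoryTailDensityTransfer (gibbsK_real_preimage_iter_eq)
open Summit.QuantumFields.YangMills.Theorems.HistoryTailSandwich (partitionFn_eq_integral_resDensity)
open Summit.QuantumFields.YangMills.Theorems.HistoryTailMechanismA (integral_mul_indicator_one_eq_setIntegral)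
open Summit.QuantumFields.YangMills.Theorems.HistoryTailAlphaConsumer (setIntegral_div_integral_le_ae)

namespace Summit.QuantumFields.YangMills.Theorems.HistoryTailLaneNumeratorIntRows

open Classical

/-! ### §2.1 The interior datum with a windowed trivial weight: the numerator bound on a joint event -/

section Concrete

variable {F : T3Family} {𝔠 : AlphaConsts F.L (suGroupModel 2).N} {γ : ℝ} {hγ : 0 < γ} {hγ1 : γ ≤ (min 𝔠.gamma0 1) ^ 2}
  (qf : ∀ K, AlphaInputsT3AC.PkgCoreRows F 𝔠 γ hγ hγ1 K) (π : AlphaInputsT3AC.PolymerT3 F)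

/-- **THE NUMERATOR BOUND ON A JOINT LARGE-PLAQUETTE EVENT FROM THE PIECES** (deterministic exponent bound 4c at this family, history mass 4a, a windowed
trivial weight `wtT` with its mass bound, a.e. supports, interaction size): for a majorant `U(W) = wtT(W)·e^{Φ(triv,W)} + Σ_{r ≠ triv} m_j(r,W)·e^{Φ(r,W)}`,
`Φ(r,W) = −mainT + Pint + Zterm` of the interior datum of a family of data cores, `∫_{E_S} U ≤ e^{−|S|·P4}·(MA + e^{Pz}·MT)`. [cite: Balaban1985UV3, (41) p.266 and (71) p.273] -/
theorem setIntegral_up_le (K j : ℕ) (S : Finset (Plaq (F.P K) j)) (θ P4 MA MT Pz : ℝ) (σ : ℕ → ℝ) (hσ : ∀ i, i < j → 0 ≤ σ i)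
    (wt : Summit.QuantumFields.Balaban3D.Carriers.Hist (F.P K) j → GaugeField (F.P K) j (Matrix.specialUnitaryGroup (Fin 2) ℂ) → ℝ)
    (hwt0 : ∀ r Wf, 0 ≤ wt r Wf)
    (U wtT : GaugeField (F.P K) j (Matrix.specialUnitaryGroup (Fin 2) ℂ) → ℝ) (hwtT0 : ∀ Wf, 0 ≤ wtT Wf)
    (hU : ∀ Wf, U Wf = wtT Wf * Real.exp (-((AlphaInputsT3AC.dataIntRows qf π).mainT K j (Summit.QuantumFields.Balaban3D.Carriers.Hist.triv (F.P K) j) Wf) +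
        (AlphaInputsT3AC.dataIntRows qf π).Pint K j (Summit.QuantumFields.Balaban3D.Carriers.Hist.triv (F.P K) j) Wf +
        (AlphaInputsT3AC.dataIntRows qf π).Zterm K j (Summit.QuantumFields.Balaban3D.Carriers.Hist.triv (F.P K) j)) +
      ∑ r ∈ Finset.univ.erase (Summit.QuantumFields.Balaban3D.Carriers.Hist.triv (F.P K) j),
        wt r Wf *
          Real.exp (-((AlphaInputsT3AC.dataIntRows qf π).mainT K j r Wf) + (AlphaInputsT3AC.dataIntRows qf π).Pint K j r Wf + (AlphaInputsT3AC.dataIntRows qf π).Zterm K j r))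
    (h4c : ∀ (r : Summit.QuantumFields.Balaban3D.Carriers.Hist (F.P K) j) (Wf : GaugeField (F.P K) j (Matrix.specialUnitaryGroup (Fin 2) ℂ)),
      (AlphaInputsT3AC.dataIntRows qf π).Adm K j r Wf → (∀ q ∈ S, θ ≤ GaugeGroup.dist1 (GaugeField.plaqHol Wf q)) →
        (S.card : ℝ) * P4 + ∑ i ∈ Finset.range j, (((AlphaInputsT3AC.lfDataIntRows qf π).LargeP K j r i).card : ℝ) * σ i ≤
          (AlphaInputsT3AC.dataIntRows qf π).mainT K j r Wf - (AlphaInputsT3AC.dataIntRows qf π).Zterm K j r)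
    (hT1 : ∀ r : Summit.QuantumFields.Balaban3D.Carriers.Hist (F.P K) j, r ≠ Summit.QuantumFields.Balaban3D.Carriers.Hist.triv (F.P K) j →
      ∀ᵐ Wf ∂fieldMeasure (F.P K) j (Matrix.specialUnitaryGroup (Fin 2) ℂ),
        wt r Wf ≠ 0 → (AlphaInputsT3AC.dataIntRows qf π).Adm K j r Wf)
    (hT1' : ∀ᵐ Wf ∂fieldMeasure (F.P K) j (Matrix.specialUnitaryGroup (Fin 2) ℂ),
      wtT Wf ≠ 0 → (AlphaInputsT3AC.dataIntRows qf π).Adm K j (Summit.QuantumFields.Balaban3D.Carriers.Hist.triv (F.P K) j) Wf)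
    (hPint : ∀ (r : Summit.QuantumFields.Balaban3D.Carriers.Hist (F.P K) j) (Wf : GaugeField (F.P K) j (Matrix.specialUnitaryGroup (Fin 2) ℂ)),
      (AlphaInputsT3AC.dataIntRows qf π).Adm K j r Wf → (AlphaInputsT3AC.dataIntRows qf π).Pint K j r Wf ≤ Pz)
    (h4a : Integrable (fun Wf : GaugeField (F.P K) j (Matrix.specialUnitaryGroup (Fin 2) ℂ) =>
        ∑ r ∈ Finset.univ.erase (Summit.QuantumFields.Balaban3D.Carriers.Hist.triv (F.P K) j),
          wt r Wf *
            Real.exp ((AlphaInputsT3AC.dataIntRows qf π).Pint K j r Wf -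
              ∑ i ∈ Finset.range j, (((AlphaInputsT3AC.lfDataIntRows qf π).LargeP K j r i).card : ℝ) * σ i))
        (fieldMeasure (F.P K) j (Matrix.specialUnitaryGroup (Fin 2) ℂ)) ∧
      ∫ Wf, ∑ r ∈ Finset.univ.erase (Summit.QuantumFields.Balaban3D.Carriers.Hist.triv (F.P K) j),
          wt r Wf *
            Real.exp ((AlphaInputsT3AC.dataIntRows qf π).Pint K j r Wf -
              ∑ i ∈ Finset.range j, (((AlphaInputsT3AC.lfDataIntRows qf π).LargeP K j r i).card : ℝ) * σ i)
        ∂fieldMeasure (F.P K) j (Matrix.specialUnitaryGroup (Fin 2) ℂ) ≤ MA)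
    (hT2 : Integrable wtT (fieldMeasure (F.P K) j (Matrix.specialUnitaryGroup (Fin 2) ℂ)) ∧
      ∫ Wf, wtT Wf ∂fieldMeasure (F.P K) j (Matrix.specialUnitaryGroup (Fin 2) ℂ) ≤ MT)
    (hUI : Integrable U (fieldMeasure (F.P K) j (Matrix.specialUnitaryGroup (Fin 2) ℂ))) :
    ∫ Wf in {Wf | ∀ q ∈ S, θ ≤ GaugeGroup.dist1 (GaugeField.plaqHol Wf q)}, U Wf ∂fieldMeasure (F.P K) j (Matrix.specialUnitaryGroup (Fin 2) ℂ) ≤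
      Real.exp (-((S.card : ℝ) * P4)) * (MA + Real.exp Pz * MT) := by
  set D := AlphaInputsT3AC.dataIntRows qf π with hD
  set W := AlphaInputsT3AC.lfDataIntRows qf π with hW
  set μ := fieldMeasure (F.P K) j (Matrix.specialUnitaryGroup (Fin 2) ℂ) with hμ
  set triv := Summit.QuantumFields.Balaban3D.Carriers.Hist.triv (F.P K) j with htriv
  set E : Set (GaugeField (F.P K) j (Matrix.specialUnitaryGroup (Fin 2) ℂ)) :=
    {Wf | ∀ q ∈ S, θ ≤ GaugeGroup.dist1 (GaugeField.plaqHol Wf q)} with hE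
  set G : GaugeField (F.P K) j (Matrix.specialUnitaryGroup (Fin 2) ℂ) → ℝ := fun Wf =>
    ∑ r ∈ Finset.univ.erase triv, wt r Wf *
      Real.exp (D.Pint K j r Wf - ∑ i ∈ Finset.range j, ((W.LargeP K j r i).card : ℝ) * σ i) with hG
  set c : ℝ := (S.card : ℝ) * P4 with hcdef
  have hEm : MeasurableSet E := by
    have hEeq : E = ⋂ q ∈ S, {Wf | θ ≤ GaugeGroup.dist1 (GaugeField.plaqHol Wf q)} := by ext Wf; simp [hE]
    rw [hEeq]
    exact S.measurableSet_biInter fun q _ =>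
      measurableSet_le measurable_const (RegularGaugeGroup.measurable_dist1.comp (measurable_plaqHol q))
  -- a.e.: every non-trivial history with non-zero weight is admissible, and so is the windowed trivial one
  have hall : ∀ᵐ Wf ∂μ, ∀ r : Summit.QuantumFields.Balaban3D.Carriers.Hist (F.P K) j, r ≠ triv → wt r Wf ≠ 0 → D.Adm K j r Wf := by
    rw [ae_all_iff]; intro r
    by_cases hr : r = triv
    · exact ae_of_all _ fun Wf h' => absurd hr h'
    · filter_upwards [hT1 r hr] with Wf hWf _ using hWf
  -- the pointwise bound on `E`
  have hpt : ∀ᵐ Wf ∂μ, Wf ∈ E → U Wf ≤ Real.exp (-c) * (G Wf + Real.exp Pz * wtT Wf) := by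
    filter_upwards [hall, hT1'] with Wf hWf hWfT hWE
    rw [hU Wf]
    -- non-trivial terms
    have hterm : ∀ r, r ≠ triv → wt r Wf * Real.exp (-(D.mainT K j r Wf) + D.Pint K j r Wf + D.Zterm K j r) ≤
        Real.exp (-c) * (wt r Wf * Real.exp (D.Pint K j r Wf - ∑ i ∈ Finset.range j, ((W.LargeP K j r i).card : ℝ) * σ i)) := by
      intro r hr
      by_cases hw : wt r Wf = 0
      · rw [hw, zero_mul, zero_mul, mul_zero]
      · have hadm := hWf r hr hw
        have h4 := h4c r Wf hadm hWE
        have hexp : Real.exp (-(D.mainT K j r Wf) + D.Pint K j r Wf + D.Zterm K j r) ≤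
            Real.exp (-c) * Real.exp (D.Pint K j r Wf - ∑ i ∈ Finset.range j, ((W.LargeP K j r i).card : ℝ) * σ i) := by
          rw [← Real.exp_add]
          exact Real.exp_le_exp.mpr (by rw [hcdef]; linarith)
        calc wt r Wf * Real.exp (-(D.mainT K j r Wf) + D.Pint K j r Wf + D.Zterm K j r)
            ≤ wt r Wf * (Real.exp (-c) *
                Real.exp (D.Pint K j r Wf - ∑ i ∈ Finset.range j, ((W.LargeP K j r i).card : ℝ) * σ i)) :=
              mul_le_mul_of_nonneg_left hexp (hwt0 r Wf)
          _ = _ := by ring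
    -- the windowed trivial term: `Pint ≤ Pz`, `Σσ ≥ 0` (4c at the trivial history)
    have htrivterm : wtT Wf * Real.exp (-(D.mainT K j triv Wf) + D.Pint K j triv Wf + D.Zterm K j triv) ≤
        Real.exp (-c) * (Real.exp Pz * wtT Wf) := by
      by_cases hw : wtT Wf = 0
      · rw [hw, zero_mul, mul_zero, mul_zero]
      · have hadm := hWfT hw
        have h4 := h4c triv Wf hadm hWE
        have hsum0 : 0 ≤ ∑ i ∈ Finset.range j, ((W.LargeP K j triv i).card : ℝ) * σ i :=
          Finset.sum_nonneg fun i hi => mul_nonneg (Nat.cast_nonneg _) (hσ i (Finset.mem_range.mp hi))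
        have hP := hPint triv Wf hadm
        have hexp : Real.exp (-(D.mainT K j triv Wf) + D.Pint K j triv Wf + D.Zterm K j triv) ≤ Real.exp (-c) * Real.exp Pz := by
          rw [← Real.exp_add]
          exact Real.exp_le_exp.mpr (by rw [hcdef]; linarith)
        calc wtT Wf * Real.exp (-(D.mainT K j triv Wf) + D.Pint K j triv Wf + D.Zterm K j triv)
            ≤ wtT Wf * (Real.exp (-c) * Real.exp Pz) := mul_le_mul_of_nonneg_left hexp (hwtT0 Wf)
          _ = Real.exp (-c) * (Real.exp Pz * wtT Wf) := by ring
    have hrest : ∑ r ∈ Finset.univ.erase triv, wt r Wf * Real.exp (-(D.mainT K j r Wf) + D.Pint K j r Wf + D.Zterm K j r) ≤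
        Real.exp (-c) * G Wf := by
      rw [hG, Finset.mul_sum]
      exact Finset.sum_le_sum fun r hr => hterm r (Finset.ne_of_mem_erase hr)
    calc wtT Wf * Real.exp (-(D.mainT K j triv Wf) + D.Pint K j triv Wf + D.Zterm K j triv) +
          ∑ r ∈ Finset.univ.erase triv, wt r Wf * Real.exp (-(D.mainT K j r Wf) + D.Pint K j r Wf + D.Zterm K j r)
        ≤ Real.exp (-c) * (Real.exp Pz * wtT Wf) + Real.exp (-c) * G Wf := add_le_add htrivterm hrest
      _ = Real.exp (-c) * (G Wf + Real.exp Pz * wtT Wf) := by ring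
  -- integrate over `E`
  have hGI : Integrable G μ := h4a.1
  have hTI : Integrable wtT μ := hT2.1
  have hRI : Integrable (fun Wf => Real.exp (-c) * (G Wf + Real.exp Pz * wtT Wf)) μ :=
    (hGI.add (hTI.const_mul _)).const_mul _
  have hG0 : ∀ Wf, 0 ≤ G Wf := fun Wf =>
    Finset.sum_nonneg fun r _ => mul_nonneg (hwt0 r Wf) (Real.exp_nonneg _)
  have hstep1 : ∫ Wf in E, U Wf ∂μ ≤ ∫ Wf in E, Real.exp (-c) * (G Wf + Real.exp Pz * wtT Wf) ∂μ :=
    integral_mono_ae hUI.integrableOn hRI.integrableOn ((ae_restrict_iff' hEm).mpr hpt)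
  have hstep2 : ∫ Wf in E, Real.exp (-c) * (G Wf + Real.exp Pz * wtT Wf) ∂μ ≤
      ∫ Wf, Real.exp (-c) * (G Wf + Real.exp Pz * wtT Wf) ∂μ :=
    setIntegral_le_integral hRI (ae_of_all _ fun Wf =>
      mul_nonneg (Real.exp_nonneg _) (add_nonneg (hG0 Wf) (mul_nonneg (Real.exp_nonneg _) (hwtT0 Wf))))
  have hstep3 : ∫ Wf, Real.exp (-c) * (G Wf + Real.exp Pz * wtT Wf) ∂μ =
      Real.exp (-c) * (∫ Wf, G Wf ∂μ + Real.exp Pz * ∫ Wf, wtT Wf ∂μ) := by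
    rw [integral_const_mul, integral_add hGI (hTI.const_mul _), integral_const_mul]
  have hstep4 : Real.exp (-c) * (∫ Wf, G Wf ∂μ + Real.exp Pz * ∫ Wf, wtT Wf ∂μ) ≤
      Real.exp (-c) * (MA + Real.exp Pz * MT) := by
    refine mul_le_mul_of_nonneg_left ?_ (Real.exp_nonneg _)
    exact add_le_add h4a.2 (mul_le_mul_of_nonneg_left hT2.2 (Real.exp_nonneg _))
  calc ∫ Wf in E, U Wf ∂μ ≤ ∫ Wf in E, Real.exp (-c) * (G Wf + Real.exp Pz * wtT Wf) ∂μ := hstep1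
    _ ≤ ∫ Wf, Real.exp (-c) * (G Wf + Real.exp Pz * wtT Wf) ∂μ := hstep2
    _ = Real.exp (-c) * (∫ Wf, G Wf ∂μ + Real.exp Pz * ∫ Wf, wtT Wf ∂μ) := hstep3
    _ ≤ Real.exp (-c) * (MA + Real.exp Pz * MT) := hstep4

end Concrete

end Summit.QuantumFields.YangMills.Theorems.HistoryTailLaneNumeratorIntRows

end
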